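import Literature.MathematicalPhysics.QuantumFieldTheory.Balaban1983to89.T3HeightwiseDensityBounds
import HarnessLib

/-!
# Route `SpecificationCompactness`, crux `UnitDensityUI` (C2, stmt-QuantumFields-28251), LINE «heightwise_stability» —
# the content of STUB 2 `stub_uiOfHeightZeroBound` (abbreviations unfolded)

Planner ym-idea-5 g9, skeleton v2 `bc/UnitDensityUI_heightwise.lean` (registered 15:14Z).  STUB 2 says: the height-`0` clause of the
tree schema `T3HeightwiseDensityBounds.HeightwiseUpperBound` — `Z_K⁻¹ · heightDensity_{K,0}(univ) ≤ C` for `π₀`-a.e. unit field, `C`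
independent of `K` — already gives the cut-off-uniform integrability of the normalised renormalised unit density `ρ̂_K / ∫ ρ̂_K dπ₀`.

Three facts, all bookkeeping over the tree's Bałaban package:
* `heightDensity_zero_univ` — at height `0` (no free top steps) and `S = univ` the descended restricted density IS `unitDensity`
  (`T3RestrictedUnitDensity.resUnitDensity_univ`; the two `fieldShift` casts agree definitionally, `K − 0 = K`);
* `integral_unitDensity` — `∫ ρ̂_K dπ₀ = Z_K` (`integral_comp_fieldShift` + `unitDensity_unitShift` + `integral_emlDensity_mul` with the
  test function `1`: the tower of Radon–Nikodym transports preserves total mass, and `ρ_0 = e^{−β_K A}`);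
* `uiOfHeightZeroBound` — hence `ρ̂_K/∫ρ̂_K ≤ C` a.e. for every `K`, so with `M := C` the positive part `(ρ̂_K/∫ρ̂_K − M)₊` vanishes a.e.
  and its integral is `0 ≤ ε`: the body of `UnitDensityUI` at `(F, γ)`.

Free-hands work of seat `ym-line-fcl-p3` g14 (cell ym-idea-1) for planner ym-idea-5.  THEOREMS ONLY (no `def`, no `sorry`).  HONEST
FRAMING: STUB 1 (`stub_heightZeroUpperBound` = Bałaban's ultraviolet stability (5)-upper/(6) at height 0, one reader with crux 26905) is
NOT proved here; no crux, route, rung, continuum limit or mass gap is proved.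
References: T. Bałaban, CMP 102 (1985) 255, (2) p. 256, (5)–(6) p. 257 [cite: Balaban1985UV3].
-/

set_option autoImplicit false

noncomputable section

open MeasureTheory Filter Set
open Literature.MathematicalPhysics.QuantumFieldTheory
open Literature.MathematicalPhysics.QuantumFieldTheory.Balaban1983to89
open Literature.MathematicalPhysics.QuantumFieldTheory.Balaban1983to89.T3UnitLawDensityEML
open Literature.MathematicalPhysics.QuantumFieldTheory.Balaban1983to89.T3RestrictedUnitDensity
open Literature.MathematicalPhysics.QuantumFieldTheory.Balaban1983to89.T3LevelShift

namespace Summit.QuantumFields.YangMills.Theorems.SpecificationCompactnessUIOfHeightZeroBound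

variable (F : T3ContinuumYM3Torus.T3Family)

/-- At height `0` with no constraint (`S = univ`) the descended restricted density of the `K`-th approximation is the renormalised unit
density `ρ̂_K` read on the unit labels. [cite: Balaban1985UV3, (2) p.256] -/
theorem heightDensity_zero_univ (γ : ℝ) (K : ℕ) (V : GaugeField (F.P 0) 0 (Matrix.specialUnitaryGroup (Fin 2) ℂ)) :
    T3TiltDescent.heightDensity F γ (Nat.zero_le K) Set.univ V = unitDensity F γ K V := by
  rw [← resUnitDensity_univ]
  rfl

/-- The renormalised unit density has total mass the partition function: `∫ ρ̂_K dπ₀ = Z_K` (`γ ≥ 0`). [cite: Balaban1985UV3, (2) p.256 + (6) p.257] -/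
theorem integral_unitDensity {γ : ℝ} (hγ : 0 ≤ γ) (K : ℕ) :
    ∫ W, unitDensity F γ K W ∂fieldMeasure (F.P 0) 0 (Matrix.specialUnitaryGroup (Fin 2) ℂ) =
      Missing.partitionFn (G := Matrix.specialUnitaryGroup (Fin 2) ℂ) (F.P K) ((F.scheme ℰp γ).β K) := by
  have h1 : ∫ W, unitDensity F γ K W ∂fieldMeasure (F.P 0) 0 (Matrix.specialUnitaryGroup (Fin 2) ℂ) =
      ∫ V, unitDensity F γ K (unitShift F K V) ∂fieldMeasure (F.P K) K (Matrix.specialUnitaryGroup (Fin 2) ℂ) :=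
    (integral_comp_fieldShift (F.sitesPerDir_unit K) (fun u => unitDensity F γ K u)).symm
  rw [h1]
  simp_rw [unitDensity_unitShift]
  have h2 := integral_emlDensity_mul F K hγ K (Nat.le_add_left K F.m) (fun _ => (1 : ℝ)) measurable_const
    ⟨1, fun _ => by simp⟩
  simp only [mul_one] at h2
  rw [h2]
  rfl

/-- **STUB 2 of LINE «heightwise_stability» (content, abbreviations unfolded).**  If `Z_K⁻¹ · heightDensity_{K,0}(univ) ≤ C` holds
`π₀`-a.e. for every `K` with one constant `C`, then the normalised unit densities `ρ̂_K/∫ρ̂_K dπ₀` are uniformly integrable, cut-off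
uniformly: for every `ε > 0`, with `M := C` and `K₀ := 0`, `∫ (ρ̂_K/∫ρ̂_K − M)₊ dπ₀ = 0 ≤ ε` for all `K`. [cite: Balaban1985UV3, (5)-(6) p.257] -/
theorem uiOfHeightZeroBound (γ : ℝ) (hγ : 0 < γ)
    (h : ∃ C : ℝ, ∀ K : ℕ, ∀ᵐ V ∂(fieldMeasure (F.P 0) 0 (Matrix.specialUnitaryGroup (Fin 2) ℂ)),
      (Missing.partitionFn (G := Matrix.specialUnitaryGroup (Fin 2) ℂ) (F.P K) ((F.scheme ℰp γ).β K))⁻¹ *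
        T3TiltDescent.heightDensity F γ (Nat.zero_le K) Set.univ V ≤ C) :
    ∀ ε : ℝ, 0 < ε → ∃ (M : ℝ) (K₀ : ℕ), ∀ K : ℕ, K₀ ≤ K →
      ∫ V, max ((∫ W, unitDensity F γ K W ∂fieldMeasure (F.P 0) 0 (Matrix.specialUnitaryGroup (Fin 2) ℂ))⁻¹ * unitDensity F γ K V - M) 0
        ∂fieldMeasure (F.P 0) 0 (Matrix.specialUnitaryGroup (Fin 2) ℂ) ≤ ε := by
  obtain ⟨C, hC⟩ := h
  intro ε hε
  refine ⟨C, 0, fun K _ => ?_⟩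
  have hae : (fun V => max ((∫ W, unitDensity F γ K W ∂fieldMeasure (F.P 0) 0 (Matrix.specialUnitaryGroup (Fin 2) ℂ))⁻¹ *
        unitDensity F γ K V - C) 0) =ᵐ[fieldMeasure (F.P 0) 0 (Matrix.specialUnitaryGroup (Fin 2) ℂ)] fun _ => (0 : ℝ) := by
    filter_upwards [hC K] with V hV
    rw [heightDensity_zero_univ, ← integral_unitDensity F hγ.le K] at hV
    exact max_eq_right (by linarith)
  rw [integral_congr_ae hae, integral_zero]
  exact hε.le

end Summit.QuantumFields.YangMills.Theorems.SpecificationCompactnessUIOfHeightZeroBound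

end
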